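import Literature.MathematicalPhysics.QuantumFieldTheory.Balaban1983to89.B9Eq367TowerQGGQInvLadder
import Literature.MathematicalPhysics.QuantumFieldTheory.Balaban1983to89.B9Eq349TowerSiteRowSeam
import Literature.MathematicalPhysics.QuantumFieldTheory.Balaban1983to89.B9Eq349ConjugatedQGGQInvSupRowTower

/-!
# `Balaban1983to89.B9Eq367TowerQGGQInvLadderOfLetters` — T. Bałaban, *Propagators for lattice gauge theories in a background field*, Commun. Math. Phys. **99** (1985) 389–434
# [Balaban1985BackgroundPropagators] (3.65)–(3.67) p. 403, Thm 3.2 (3.48) p. 398, Thm 3.11 p. 416, (3.25) p. 394, with [Balaban1984PropagatorsII] (2.51)–(2.55) p. 232, (2.66) p. 234: **THE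
# TWO-BACKGROUND LADDER FOR THE NE9 CHAIN's `k`-LEVEL INVERSE THIRD OPERATOR `c_k(U) = (Q̃′_kG′_k(U)²Q̃′_k(U)†)⁻¹` FROM THE CHAIN's OWN LETTERS** — the rows of `c_k(U)` and `c_k(1)` are
# leaf-03's Combes–Thomas letter `B9Eq349ConjugatedQGGQInvSupRowTower.local_letter_QGGQInvk` (blocks = sites, `(2∕κ₁)e^ρ e^{−ρ d_∞}`), read as block majorants over `towerGeom` by
# `B9Eq349TowerSiteRowSeam`, and fed to `B9Eq367TowerQGGQInvLadder.exists_hasMajorant_QGGQInv_sub_flat`: **`conj b (readA φ c_k(U)) − conj b (readA φ c_k(1)) ≺ K·α·e^{−δ d}`** on print's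
# small-field class with `α_X, K, δ` BEFORE `n, η, m, U` — functions of `(d, κ₁, ρ, M_φ, M_φ′, M₂, Σ‖b_i‖)` and the word ladder — the displayed letters `(C_Q, γ, κ₁, β, ρ, small, small2,
# r)` of leaf-03 entering as HYPOTHESES at `U` and at `1` (the chain's O-NE9-1 walls, unchanged)

statement-level skeleton of published theorems with citation tags; proofs where landed; nothing here is a claim about the Yang–Mills mass gap

CITATION HEADER (lean-in-tree rule).  Audit cell `pub-balaban`, sub-cell `t4`, BINDER row NE9; NE9 crux-team LEAF PROVER 01 (`b2b-balaban-t4-ne9-formalise-leaf-01`,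
gen 99; bears_on: R4/N22).  Vocabulary BY NAME: leaf-03's `B9Eq349ConjugatedQGGQInvSupRowTower.local_letter_QGGQInvk` (its letters verbatim), this lineage's
`B9Eq349TowerSiteRowSeam.hasMajorant_conj_readA_of_siteRow_tdist`, `B9Eq367TowerQGGQInvLadder.exists_hasMajorant_QGGQInv_sub_flat`, `B9Eq341TowerBlockGeometry.towerGeom`, r06's
`B9Eq352DivFormLetters.conj`, `B9Eq324PenaltyKernelForm.readA`, pv08's `B6RandomWalk.HasMajorant`.  Sources read through those files' verbatim quotations: [Balaban1985BackgroundPropagators]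
pp. 394, 398, 403, 416; [Balaban1984PropagatorsII] pp. 232, 234.  [folklore] COMPOSITION BY NAME; NOTHING of print's proofs is reproduced beyond what the named files prove.

WHAT IS PROVED (sorry-free; proof lane — no `def`).
* **`exists_hasMajorant_QGGQInvk_sub_flat`** — given `κ₁ > 0`, `0 < ρ`: `∃ α_X > 0, K ≥ 0, δ > 0` BEFORE the lattice such that on print's small-field class (plus fibre-isometric level
  transporters), for ANY positivity witnesses, ANY `M, R_r, H`, and leaf-03's letters at `U` and at `1` (adjointness `hRS`, `‖Q̃′‖ ≤ C_Q`, coercivity `γ`, the third operator's lower bound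
  `κ₁`, right inverses `c(U)`, `c(1)`, the window parameters `β, ρ` with `small`, `small2`, the site restrictions `r`): the difference of the realified `𝔸`-read inverse third operators
  has the block majorant `K·α·e^{−δ·d(a,a′)}` over `towerGeom` (blocks = sites).
HONEST SCOPE.  Junction only; the letters are DISPLAYED hypotheses (their inhabitants are the chain's walls: KAPPA1, γ, C_Q — O-NE9-1, #5 UNRULED); constants crude (NOT print's); NOT `R_k`,
NOT the bond `G_k`; NE9 NOT PRINTED ∕ NOT PROVED; spine PROVED 0∕9; rung (B)+1 finite T⁴ — NOT infinite volume, NOT mass gap, NOT BetaPertH, NOT Clay.  HONEST DEPENDENCY: continuum YM on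
T⁴ ⇐ BetaPertH ∧ nine spine estimates (0/9 proved); BetaPertH ⇐ (D1) ∧ (D4) ∧ CAP+tail; G-an2-4 gates asym, D1 and NE2/3/4.  NEW file; nothing modified.  Net new unproved facts: 0.
-/

noncomputable section

open scoped BigOperators InnerProductSpace

namespace Literature.MathematicalPhysics.QuantumFieldTheory.Balaban1983to89.B9Eq367TowerQGGQInvLadderOfLetters

open B4Sect5Torus (TSite tdist)
open B7Prop1Explicit (U1)
open B9SectCLatticeCarrier (Bond shift)
open B9Eq311L2Pairing (WL2)
open B11Eq103H1Complex (SiteL2K covDerivL2K)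
open B9Eq310HessianOperator (adTransportW)
open B9Eq315QTower (towerP UlevOf)
open B9Eq326OperatorTower (QprimeTowerW)
open B9Eq324DeltaPrimeATower (laplacePrimeAk GpOfUk)
open B6RandomWalk (HasMajorant)
open B9Thm34Ext (toB6)
open B9Eq352DivFormLetters (conj)
open B9Eq324PenaltyKernelForm (readA)
open B9Eq341TowerBlockGeometry (towerGeom)
open B9Eq349ConjugatedQGGQInvSupRowTower (local_letter_QGGQInvk)
open B9Eq349TowerSiteRowSeam (hasMajorant_conj_readA_of_siteRow_tdist)
open B9Eq367TowerQGGQInvLadder (exists_hasMajorant_QGGQInv_sub_flat)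

variable {d : ℕ} (L : ℕ) [NeZero L] {𝔸 : Type*} [NormedRing 𝔸] [NormedAlgebra ℂ 𝔸] [CompleteSpace 𝔸] [NormOneClass 𝔸] [StarRing 𝔸] [FiniteDimensional ℂ 𝔸]
  {W : Type*} [NormedAddCommGroup W] [InnerProductSpace ℂ W] [FiniteDimensional ℂ W] (φ : W ≃ₗ[ℂ] 𝔸) {a' Mφ Mφ' : ℝ}
  (hMφ : 0 ≤ Mφ) (hMφ' : 0 ≤ Mφ') (hφn : ∀ w, ‖φ w‖ ≤ Mφ * ‖w‖) (hφn' : ∀ X, ‖φ.symm X‖ ≤ Mφ' * ‖X‖) (ha' : 0 < a')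
  {r : ℝ} (hr0 : 0 ≤ r) (hr1 : r < 1)
  (τ : 𝔸 →ₗ[ℂ] ℂ) (hτ₂ : ∀ X Y : 𝔸, τ (X * Y) = τ (Y * X)) (hφτ : ∀ X Y : 𝔸, ⟪φ.symm X, φ.symm Y⟫_ℂ = τ (star X * Y))
  {ι : Type} [Fintype ι] [DecidableEq ι] (b : Module.Basis ι ℝ 𝔸) {M₂ : ℝ} (hM₂ : 0 ≤ M₂) (hrepr : ∀ (v : 𝔸) (i : ι), |b.repr v i| ≤ M₂ * ‖v‖)

include hMφ hMφ' hφn hφn' ha' hr0 hr1 hτ₂ hφτ hM₂ hrepr in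
/-- **THE TWO-BACKGROUND LADDER FOR `c_k = (Q̃′_kG′_k²Q̃′_k†)⁻¹` FROM THE CHAIN's LETTERS** (see the module docstring).
[cite: Balaban1985BackgroundPropagators, (3.65)–(3.67) p.403, Thm 3.2 (3.48) p.398, Thm 3.11 p.416, (3.25) p.394; Balaban1984PropagatorsII, (2.51)–(2.55) p.232, (2.66) p.234] -/
theorem exists_hasMajorant_QGGQInvk_sub_flat (hd : 1 ≤ d) (hL3 : 3 ≤ L) {κ₁ ρ : ℝ} (hκ₁ : 0 < κ₁) (hρ0 : 0 < ρ) :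
    ∃ αX K δ : ℝ, 0 < αX ∧ 0 ≤ K ∧ 0 < δ ∧
      ∀ (n : ℕ) (η : ℝ), η * (L : ℝ) ^ (n + 1) = 1 →
      ∀ (c₀ c₁ : ℝ) [Fact (0 < c₀)] [Fact (0 < c₁)], c₀ * ((L : ℝ) ^ (n + 1)) ^ d = c₁ →
      ∀ (m : Fin d → ℕ) [∀ i, NeZero (m i)] (U : Bond d (towerP L m (n + 1)) → 𝔸ˣ) (α : ℝ), 0 ≤ α → α ≤ αX →
        (∀ bd, U bd ∈ U1 𝔸) → (∀ bd, ‖(U bd : 𝔸) - 1‖ ≤ α * η) →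
        (∀ (x : TSite d (towerP L m (n + 1))) (μ ν : Fin d), ‖(U (shift ν x, μ) : 𝔸) - (U (x, μ) : 𝔸)‖ ≤ α * η ^ 2) →
      ∀ (εU : ℕ → ℝ), (∀ j, 0 ≤ εU j) → (∀ j, εU j ≤ 1) → (∀ j < n + 1, εU j ≤ α * r ^ j) →
        (∀ (j : ℕ) (bd : Bond d (towerP L m (j + 1))), ‖(UlevOf L m (n + 1) U j bd : 𝔸) - 1‖ ≤ εU j) →
        (∀ (j : ℕ) (bd : Bond d (towerP L m (j + 1))), UlevOf L m (n + 1) U j bd ∈ U1 𝔸) →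
        (∀ (j : ℕ) (bd : Bond d (towerP L m (j + 1))) (w : W), ‖adTransportW φ (UlevOf L m (n + 1) U j) bd w‖ ≤ ‖w‖) →
      ∀ (hposU : ∀ x : SiteL2K ℂ d (towerP L m (n + 1)) c₀ W, x ≠ 0 → 0 < RCLike.re ⟪x, laplacePrimeAk L m n φ η U a' (c₁ := c₁) x⟫_ℂ)
        (hpos₁ : ∀ x : SiteL2K ℂ d (towerP L m (n + 1)) c₀ W, x ≠ 0 →
          0 < RCLike.re ⟪x, laplacePrimeAk L m n φ η (fun _ : Bond d (towerP L m (n + 1)) => (1 : 𝔸ˣ)) a' (c₁ := c₁) x⟫_ℂ)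
        (M Rr : ℝ) (H : Prop)
        -- leaf-03's background-free letters
        (hm : ∀ i, 1 ≤ m i) (CQ : ℝ) (hCQ : 0 ≤ CQ) (γ : ℝ) (hγ : 0 < γ) (hγ1 : γ ≤ 1) (β : ℝ) (hβ : 0 ≤ β) (hβ1 : β ≤ 1) (hρ1 : ρ ≤ 1)
        (hβD : 2 * ρ * (Mφ * Mφ') * Real.sqrt d ≤ β) (hβQ : 2 * ρ * CQ ≤ β) (small : 3 * (1 + a') * β ^ 2 ≤ γ / 4)
        (small2 : β * ((4 / γ + CQ * ((4 / γ) ^ 2 * (3 + a' * (2 * CQ + 1)))) * (4 / γ) * (2 * CQ + 1)) ≤ κ₁ / 2)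
        (rOp : TSite d m → SiteL2K ℂ d m c₁ W →L[ℂ] SiteL2K ℂ d m c₁ W)
        (hrOp : ∀ (y : TSite d m) (g : SiteL2K ℂ d m c₁ W) (y' : TSite d m),
          WL2.equiv ℂ (fun _ : TSite d m => c₁) W (rOp y g) y' = if y' = y then WL2.equiv ℂ (fun _ : TSite d m => c₁) W g y' else 0)
        -- the displayed letters of leaf-03's inverse row at `U`
        (hRSU : ∀ (bd : Bond d (towerP L m (n + 1))) (v u : W), ⟪adTransportW φ U bd v, u⟫_ℂ = ⟪v, adTransportW φ (fun bd => (U bd)⁻¹) bd u⟫_ℂ)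
        (hQU : ∀ s, ‖((WL2.linearEquiv ℂ ℂ (fun _ : TSite d m => c₁)).symm.toLinearMap ∘ₗ QprimeTowerW L m n φ U (c₀ := c₀)) s‖ ≤ CQ * ‖s‖)
        (coerciveU : ∀ f : SiteL2K ℂ d (towerP L m (n + 1)) c₀ W, γ * ‖f‖ ^ 2 ≤ ‖(covDerivL2K ℂ c₀ ((η : ℂ))⁻¹ (adTransportW φ U)) f‖ ^ 2 +
          a' * ‖((WL2.linearEquiv ℂ ℂ (fun _ : TSite d m => c₁)).symm.toLinearMap ∘ₗ QprimeTowerW L m n φ U (c₀ := c₀)) f‖ ^ 2)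
        (hXU : ∀ g : SiteL2K ℂ d m c₁ W, κ₁ * ‖g‖ ^ 2 ≤ RCLike.re ⟪g,
          ((WL2.linearEquiv ℂ ℂ (fun _ : TSite d m => c₁)).symm.toLinearMap ∘ₗ QprimeTowerW L m n φ U (c₀ := c₀))
            (GpOfUk L m n φ η U a' (c₁ := c₁) hposU (GpOfUk L m n φ η U a' (c₁ := c₁) hposU
              (LinearMap.adjoint ((WL2.linearEquiv ℂ ℂ (fun _ : TSite d m => c₁)).symm.toLinearMap ∘ₗ QprimeTowerW L m n φ U (c₀ := c₀)) g)))⟫_ℂ)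
        (cU : SiteL2K ℂ d m c₁ W →ₗ[ℂ] SiteL2K ℂ d m c₁ W)
        (hcU : ∀ v, ((WL2.linearEquiv ℂ ℂ (fun _ : TSite d m => c₁)).symm.toLinearMap ∘ₗ QprimeTowerW L m n φ U (c₀ := c₀))
            (GpOfUk L m n φ η U a' (c₁ := c₁) hposU (GpOfUk L m n φ η U a' (c₁ := c₁) hposU
              (LinearMap.adjoint ((WL2.linearEquiv ℂ ℂ (fun _ : TSite d m => c₁)).symm.toLinearMap ∘ₗ QprimeTowerW L m n φ U (c₀ := c₀)) (cU v)))) = v)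
        -- the displayed letters of leaf-03's inverse row at `(fun _ : Bond d (towerP L m (n + 1)) => (1 : 𝔸ˣ))`
        (hRS1 : ∀ (bd : Bond d (towerP L m (n + 1))) (v u : W), ⟪adTransportW φ (fun _ : Bond d (towerP L m (n + 1)) => (1 : 𝔸ˣ)) bd v, u⟫_ℂ = ⟪v, adTransportW φ (fun bd => ((fun _ : Bond d (towerP L m (n + 1)) => (1 : 𝔸ˣ)) bd)⁻¹) bd u⟫_ℂ)
        (hQ1 : ∀ s, ‖((WL2.linearEquiv ℂ ℂ (fun _ : TSite d m => c₁)).symm.toLinearMap ∘ₗ QprimeTowerW L m n φ (fun _ : Bond d (towerP L m (n + 1)) => (1 : 𝔸ˣ)) (c₀ := c₀)) s‖ ≤ CQ * ‖s‖)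
        (coercive1 : ∀ f : SiteL2K ℂ d (towerP L m (n + 1)) c₀ W, γ * ‖f‖ ^ 2 ≤ ‖(covDerivL2K ℂ c₀ ((η : ℂ))⁻¹ (adTransportW φ (fun _ : Bond d (towerP L m (n + 1)) => (1 : 𝔸ˣ)))) f‖ ^ 2 +
          a' * ‖((WL2.linearEquiv ℂ ℂ (fun _ : TSite d m => c₁)).symm.toLinearMap ∘ₗ QprimeTowerW L m n φ (fun _ : Bond d (towerP L m (n + 1)) => (1 : 𝔸ˣ)) (c₀ := c₀)) f‖ ^ 2)
        (hX1 : ∀ g : SiteL2K ℂ d m c₁ W, κ₁ * ‖g‖ ^ 2 ≤ RCLike.re ⟪g,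
          ((WL2.linearEquiv ℂ ℂ (fun _ : TSite d m => c₁)).symm.toLinearMap ∘ₗ QprimeTowerW L m n φ (fun _ : Bond d (towerP L m (n + 1)) => (1 : 𝔸ˣ)) (c₀ := c₀))
            (GpOfUk L m n φ η (fun _ : Bond d (towerP L m (n + 1)) => (1 : 𝔸ˣ)) a' (c₁ := c₁) hpos₁ (GpOfUk L m n φ η (fun _ : Bond d (towerP L m (n + 1)) => (1 : 𝔸ˣ)) a' (c₁ := c₁) hpos₁
              (LinearMap.adjoint ((WL2.linearEquiv ℂ ℂ (fun _ : TSite d m => c₁)).symm.toLinearMap ∘ₗ QprimeTowerW L m n φ (fun _ : Bond d (towerP L m (n + 1)) => (1 : 𝔸ˣ)) (c₀ := c₀)) g)))⟫_ℂ)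
        (c1 : SiteL2K ℂ d m c₁ W →ₗ[ℂ] SiteL2K ℂ d m c₁ W)
        (hc1 : ∀ v, ((WL2.linearEquiv ℂ ℂ (fun _ : TSite d m => c₁)).symm.toLinearMap ∘ₗ QprimeTowerW L m n φ (fun _ : Bond d (towerP L m (n + 1)) => (1 : 𝔸ˣ)) (c₀ := c₀))
            (GpOfUk L m n φ η (fun _ : Bond d (towerP L m (n + 1)) => (1 : 𝔸ˣ)) a' (c₁ := c₁) hpos₁ (GpOfUk L m n φ η (fun _ : Bond d (towerP L m (n + 1)) => (1 : 𝔸ˣ)) a' (c₁ := c₁) hpos₁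
              (LinearMap.adjoint ((WL2.linearEquiv ℂ ℂ (fun _ : TSite d m => c₁)).symm.toLinearMap ∘ₗ QprimeTowerW L m n φ (fun _ : Bond d (towerP L m (n + 1)) => (1 : 𝔸ˣ)) (c₀ := c₀)) (c1 v)))) = v)
,
      HasMajorant (g := toB6 (towerGeom L m n η M) Rr H) (fun q : TSite d m × ι => q.1) (conj b (readA φ cU) - conj b (readA φ c1))
        (fun a a' => K * α * Real.exp (-(δ * (towerGeom L m n η M).dist a a'))) := by
  have hKc : 0 ≤ M₂ * (∑ i, ‖b i‖) * (Mφ * Mφ') * (2 / κ₁ * Real.exp ρ) := by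
    have : 0 ≤ ∑ i, ‖b i‖ := Finset.sum_nonneg fun i _ => norm_nonneg _
    positivity
  have hδc : 0 < ρ / d := div_pos hρ0 (by exact_mod_cast hd)
  obtain ⟨αX, K, δ, hαX, hK, hδ, HX⟩ :=
    exists_hasMajorant_QGGQInv_sub_flat L φ hMφ hMφ' hφn hφn' ha' hr0 hr1 τ hτ₂ hφτ b hM₂ hrepr hd hL3 hKc hδc
  refine ⟨αX, K, δ, hαX, hK, hδ, ?_⟩
  intro n η hη c₀ c₁ _ _ hc m _ U α hα0 hαle hU1 hUs hUw εU hε0 hε1 hεr hlev hlev1 hRlev hposU hpos₁ M Rr H hm CQ hCQ γ hγ hγ1 β hβ hβ1 hρ1 hβD hβQ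
    small small2 rOp hrOp hRSU hQU coerciveU hXU cU hcU hRS1 hQ1 coercive1 hX1 c1 hc1
  -- the rows of `c(U)` and `c(1)` (leaf-03) as block majorants over `towerGeom` (blocks = sites)
  have hrowU := hasMajorant_conj_readA_of_siteRow_tdist L m n η M Rr H φ hMφ hMφ' hφn hφn' b hM₂ hrepr hd cU (by positivity) hρ0.le
    (fun v g F hgv hgF x => local_letter_QGGQInvk hφn hφn' hMφ hMφ' hU1 hRSU hposU hm hη ha'.le hCQ hQU hγ hγ1 coerciveU hκ₁ hXU cU hcU hβ hβ1 hρ0.le hρ1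
      hβD hβQ small small2 hrOp v g F hgv hgF x)
  have hU11 : ∀ bd : Bond d (towerP L m (n + 1)), (fun _ : Bond d (towerP L m (n + 1)) => (1 : 𝔸ˣ)) bd ∈ U1 𝔸 := fun _ => one_mem _
  have hrow1 := hasMajorant_conj_readA_of_siteRow_tdist L m n η M Rr H φ hMφ hMφ' hφn hφn' b hM₂ hrepr hd c1 (by positivity) hρ0.le
    (fun v g F hgv hgF x => local_letter_QGGQInvk hφn hφn' hMφ hMφ' hU11 hRS1 hpos₁ hm hη ha'.le hCQ hQ1 hγ hγ1 coercive1 hκ₁ hX1 c1 hc1 hβ hβ1 hρ0.le hρ1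
      hβD hβQ small small2 hrOp v g F hgv hgF x)
  -- the right-inverse relations as operator identities
  have hXcU : (((WL2.linearEquiv ℂ ℂ (fun _ : TSite d m => c₁)).symm.toLinearMap ∘ₗ QprimeTowerW L m n φ U (c₀ := c₀)) ∘ₗ
      (GpOfUk L m n φ η U a' (c₁ := c₁) hposU ∘ₗ GpOfUk L m n φ η U a' (c₁ := c₁) hposU) ∘ₗ
        LinearMap.adjoint ((WL2.linearEquiv ℂ ℂ (fun _ : TSite d m => c₁)).symm.toLinearMap ∘ₗ QprimeTowerW L m n φ U (c₀ := c₀))) ∘ₗ cU = LinearMap.id :=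
    LinearMap.ext fun v => by simpa only [LinearMap.comp_apply, LinearMap.id_apply] using hcU v
  have hXc1 : (((WL2.linearEquiv ℂ ℂ (fun _ : TSite d m => c₁)).symm.toLinearMap ∘ₗ QprimeTowerW L m n φ (fun _ : Bond d (towerP L m (n + 1)) => (1 : 𝔸ˣ)) (c₀ := c₀)) ∘ₗ
      (GpOfUk L m n φ η (fun _ : Bond d (towerP L m (n + 1)) => (1 : 𝔸ˣ)) a' (c₁ := c₁) hpos₁ ∘ₗ GpOfUk L m n φ η (fun _ : Bond d (towerP L m (n + 1)) => (1 : 𝔸ˣ)) a' (c₁ := c₁) hpos₁) ∘ₗ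
        LinearMap.adjoint ((WL2.linearEquiv ℂ ℂ (fun _ : TSite d m => c₁)).symm.toLinearMap ∘ₗ QprimeTowerW L m n φ (fun _ : Bond d (towerP L m (n + 1)) => (1 : 𝔸ˣ)) (c₀ := c₀))) ∘ₗ c1 = LinearMap.id :=
    LinearMap.ext fun v => by simpa only [LinearMap.comp_apply, LinearMap.id_apply] using hc1 v
  exact HX n η hη c₀ c₁ hc m U α hα0 hαle hU1 hUs hUw εU hε0 hε1 hεr hlev hlev1 hRlev hposU hpos₁ M Rr H cU c1 hXcU hXc1 hrowU hrow1

end Literature.MathematicalPhysics.QuantumFieldTheory.Balaban1983to89.B9Eq367TowerQGGQInvLadderOfLetters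

end
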